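import Summits.QuantumFields.BalabanUV.Beta.GAN24.OneStepConstraintLetters
import Summits.QuantumFields.BalabanUV.Beta.GAN24.BlockCubePoincare

/-!
# `BalabanUV.Beta.GAN24.OneStepConstraintPoincare` — binder row G-an2-4 ∕ (CONV-C), routes C-R6° («VALUES») × R7 («TWO CURRENCIES»), PART 174 (file 2 ∕ 2):
# THE BLOCK POINCARÉ INEQUALITY ON THE KERNEL OF BAŁABAN's ONE-STEP AVERAGING — `(re QB)·u = 0 ⟹ |u|² ≤ 2R^d(R−1)²(d²+R)·Σ_{(x,μ),ν}|u_μ(x+e′_ν) − u_μ(x)|²`,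
# VOLUME-FREE, generic in `(N, R, M, d)`; hence «gradient-form lower bound ⟹ kernel coercivity on `ker QB`» (PART 169 ∕ 170's letter `hker`, PART 173's `hkerC`)
# (unit b2b-balaban-gan24-p3, gen 59; v1)

NOT IN PRINT IN THIS FORM; OUR PROOF ([folklore]: a finite-difference Poincaré inequality on the `R`-blocks of the two-level torus, BY NAME over NE2's
`BalabanLineAverage.QB_apply` ((1.11) ∕ (1.18) entrywise), `BalabanAveragedTowerModes` ∕ `B5G183RateTorus(W)` (`cpt ∕ off`, the block tiling), b05's `B5RealFields` (`reM`,
`IsReal.im_eq_zero`), `B5Prop11Lower.nsq`, `B5Block118.tstep`, PART 167 `isReal_QB`, PART 168 `OneStepConstraintLetters` (`ofReal_re_QB`, `sum_eq_sum_par_off`) and the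
torus-free cube calculus of file 1 ∕ 2 `BlockCubePoincare` (`block_sq_sum_le`).  [Balaban1984PropagatorsII] Lemma 2.4 (2.128) p. 245 and (2.153) ∕ (2.157) pp. 249–250 LOCATE
Bałaban's own constrained lower bound — there for the CURL form `|∂B|²` under the axial gauge `B(Γ_{y,x}) = 0`; the inequality below is the plain full-gradient statement for
the linear constraint `QB = 0` alone, which is what a GRADIENT-FORM lower bound on a fine quadratic form consumes.  Nothing printed is a hypothesis.)
HONEST FRAMING (cell contract, verbatim): «discharging `BetaPertH` makes Bałaban's UV stability UNCONDITIONAL — a real constructive-QFT result; it is NOT the continuum limit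
and NOT the Clay problem.»  HONEST DEPENDENCY (verbatim): «continuum YM on T⁴ ⇐ BetaPertH ∧ nine spine estimates (0/9 proved); BetaPertH ⇐ (D1) ∧ (D4) ∧ CAP+tail; G-an2-4 gates
asym, D1 and NE2/3/4.»

WHY (census V198 (d), gen 58).  After PARTs 168–173 every constraint-side letter of the one-loop step is typed for `Q̃ = re (QB N R M)`; the decay ∕ step-rate ENDs of
`𝒮, ℋ, 𝒢` hold modulo model-side letters of the fine form `H`, among them ONE genuinely new input: a KERNEL COERCIVITY `(re QB)z = 0 ⟹ γ₀|z|² ≤ ⟨z, Hz⟩` (PART 169 `coercive_reg_QB`,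
PART 170 `abs_flucCov_le_QB`, PART 173 `ker_coercive_reM_QB` ∕ `abs_flucCov_le_QB_of_complexLetters`).  A fine form that kills constants (as the lineage's `Σ_k` does:
`unitCovB_mulVec_cst`) can at best dominate a GRADIENT form `γ·Σ_{(x,μ),ν}|u_μ(x+e′_ν) − u_μ(x)|²`; THIS FILE is the constraint-side half that turns such a bound into the kernel
coercivity: on `ker (re QB)` the gradient form dominates `|u|²` with a constant depending on `(d, R)` only — NOT on `N`, NOT on the torus `M`.

THE ARGUMENT (hub-free, two local energies).  Row `(y, μ)` of `(re QB)u = 0` reads `Σ_{j∈[0,R)^d} Σ_{t<R} u_μ(R·y + j + t·e′_μ) = 0` (`reM_QB_mulVec_apply`).  File 1's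
`block_sq_sum_le` with `F j t = u_μ(R·y + j + t·e′_μ)` gives `Σ_{x∈B(y)} u_μ(x)² ≤ R^d·2(R−1)²(d²·CE_{y,μ} + LE_{y,μ})` with the local cube energy
`CE_{y,μ} = Σ_{x∈B(y)} Σ_ν |u_μ(x+e′_ν) − u_μ(x)|²` (a bump inside the block is one fine step, `off_update_succ`) and the local contour energy
`LE_{y,μ} = Σ_{x∈B(y)} Σ_{s<R} |u_μ(x+s·e′_μ+e′_μ) − u_μ(x+s·e′_μ)|²`; summed over `(y, μ)`, `Σ_y CE_{y,μ}` is the `μ`-component's gradient energy (the blocks tile the torus,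
`sum_eq_sum_par_off`) and `Σ_y LE_{y,μ}` is `R` times its `e′_μ`-part (`sum_par_off_tstep`, translation invariance), whence `2R^d(R−1)²(d² + R)`.  No optimality is claimed.

WHAT THIS FILE PROVES (0 sorry, 0 `def`; `N, R ≥ 1`, every torus `M`, every `d`):
* §1 torus bookkeeping: `off_update_succ` (`off(j[ν ↦ j_ν+1]) = off j + e′_ν`), **`QB_mulVec_apply`** ∕ **`reM_QB_mulVec_apply`** (rows of `QB·w` and of `(re QB)·u` as block × contour
  sums — (1.11) ∕ (1.18) applied to a field).
* §2 `sum_par_off_tstep` (`Σ_y Σ_j Σ_{s<R} Ψ(R·y + j + s·e′_μ) = R·Σ_x Ψ(x)`), **`block_sq_sum_le_QB`** (one block of the torus), **`dotProduct_self_le_gradSq_of_reM_QB`** — THE BLOCK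
  POINCARÉ INEQUALITY ON `ker (re QB)`: `(re QB)·u = 0 ⟹ u ⬝ᵥ u ≤ 2R^d(R−1)²(d²+R)·Σ_{(x,μ)} Σ_ν (u(x+e′_ν, μ) − u(x, μ))²`; **`ker_coercive_of_gradSq`** — a gradient-form
  lower bound `γ·Σ|∇u|² ≤ ⟨u,Hu⟩` (`γ ≥ 0`) gives PART 169 ∕ 170's letter `hker` with `γ₀ = γ ∕ (2R^d(R−1)²(d²+R))`.
* §3 the `ℂ` currency: `re_QB_mulVec` ∕ `im_QB_mulVec`, **`nsq_le_gradSq_of_QB`** (`QB·v = 0 ⟹ nsq v ≤ 2R^d(R−1)²(d²+R)·Σ_{(x,μ),ν}‖v(x+e′_ν,μ) − v(x,μ)‖²`) and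
  **`ker_coerciveC_of_gradSq`** — PART 173's `hkerC` from `γ·Σ‖∇v‖² ≤ re⟨v, Av⟩`.
* §4 along the tower: **`nsq_le_gradSq_of_QBlev`**, **`ker_coerciveC_of_gradSq_lev`** — the same two statements for `QBlev L M k` at EVERY level `k` with ONE constant
  `2L^d(L−1)²(d²+L)` (census V197's option (ii) is `k = 0`; `QBlev L M k = QB (lev L k) L M` by definition).
WHAT IT IS NOT: no fine form of the lineage is touched — WHICH `H` (census V197) and whether the block-lattice image of `Σ_k` dominates a gradient form (the (2.153)-type input,
model side) are NOT addressed; the constant is not optimised; King's plain block averaging `Qavg` is not treated (its kernel Poincaré inequality is file 1's `block_sq_sum_le`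
with `LE = 0` read on `t ≡ 0`, left to a consumer who names it).  SUPPLIER work; no consumer of record yet; NEVER «G-an2-4 closed»; NOT (CONV-C), NOT D1, NOT `BetaPertH`,
NOT continuum, NOT Clay.  Records: `HOME/b2b-balaban-gan24-p3/gen59/README.md`.
-/

noncomputable section

open scoped BigOperators ComplexConjugate Matrix
open Finset Matrix

namespace Summit.QuantumFields.BalabanUV.Beta.GAN24.OneStepConstraintPoincare

open Literature.MathematicalPhysics.QuantumFieldTheory.Balaban1983to89
open Literature.MathematicalPhysics.QuantumFieldTheory.Balaban1983to89.B5Prop11Plancherel (Tor fine unitVec)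
open Literature.MathematicalPhysics.QuantumFieldTheory.Balaban1983to89.B5Block118 (tstep tstep_zero tstep_succ)
open Literature.MathematicalPhysics.QuantumFieldTheory.Balaban1983to89.B5G183RateTorus (cpt)
open Literature.MathematicalPhysics.QuantumFieldTheory.Balaban1983to89.B5G183RateTorusW (off)
open Literature.MathematicalPhysics.QuantumFieldTheory.Balaban1983to89.B5Prop11Lower (nsq nsq_nonneg)
open Literature.MathematicalPhysics.QuantumFieldTheory.Balaban1983to89.B5RealFields (IsReal reM reM_apply)
open Summit.QuantumFields.BalabanUV.T4Continuum.BalabanLineAverage (QB QB_apply)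
open Summit.QuantumFields.BalabanUV.T4Continuum.BalabanAveragedTowerModes (par)
open Summit.QuantumFields.BalabanUV.Beta.GAN24.FirstOrderModelRealLetters (isReal_QB)
open Summit.QuantumFields.BalabanUV.Beta.GAN24.OneStepConstraintLetters (ofReal_re_QB sum_eq_sum_par_off)
open Summit.QuantumFields.BalabanUV.Beta.GAN24.BlockCubePoincare (block_sq_sum_le)
open Literature.MathematicalPhysics.QuantumFieldTheory.Balaban1983to89.B5G183RateUnitTower (lev)
open Summit.QuantumFields.BalabanUV.T4Continuum.BalabanAveragedTowerUnit (idx QBlev)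

/-! ## §1 Torus bookkeeping: bumps inside a block, rows of `QB·w` and of `(re QB)·u` -/

section Torus

variable {d : ℕ} (N R : ℕ) [NeZero N] [NeZero R] (M : Fin d → ℕ) [hM : ∀ μ, NeZero (M μ)]

omit [NeZero N] [NeZero R] hM in
/-- **a bump inside the block is one fine step**: `off(j[ν ↦ j_ν + 1]) = off j + e′_ν`. [folklore] -/
theorem off_update_succ (j : Fin d → Fin R) (ν : Fin d) (h : (j ν : ℕ) + 1 < R) :
    off N R M (Function.update j ν ⟨(j ν : ℕ) + 1, h⟩) = off N R M j + unitVec (fine (R * N) M) ν := by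
  funext ν'
  simp only [off, unitVec, Pi.add_apply]
  by_cases hν : ν' = ν
  · subst hν
    rw [Function.update_self, Pi.single_eq_same]
    push_cast
    rfl
  · rw [Function.update_of_ne hν, Pi.single_eq_of_ne hν, add_zero]

/-- **`QB_mulVec_apply` — THE ROWS OF `QB·w`** ((1.11) ∕ (1.18) applied to a fine field): `(QB·w)_{(y,μ)} = R^{−(d+1)} Σ_{j∈[0,R)^d} Σ_{t<R} w(R·y + j + t·e′_μ, μ)`.
[cite: Balaban1984PropagatorsI, (1.11) p.19, (1.18) p.20] [folklore] -/
theorem QB_mulVec_apply (w : Tor (fine (R * N) M) × Fin d → ℂ) (i : Tor (fine N M) × Fin d) :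
    (QB N R M *ᵥ w) i = ((R : ℂ) ^ (d + 1))⁻¹ *
      ∑ j : Fin d → Fin R, ∑ t : Fin R, w (cpt N R M i.1 + off N R M j + tstep (fine (R * N) M) i.2 (t : ℕ), i.2) := by
  simp only [Matrix.mulVec, dotProduct, QB_apply]
  simp_rw [mul_assoc, ← Finset.mul_sum]
  congr 1
  simp_rw [Finset.sum_mul]
  rw [Finset.sum_comm]
  refine Finset.sum_congr rfl fun j _ => ?_
  rw [Finset.sum_comm]
  refine Finset.sum_congr rfl fun t _ => ?_
  simp_rw [ite_mul, one_mul, zero_mul]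
  rw [Finset.sum_ite_eq' Finset.univ]
  simp

/-- **`reM_QB_mulVec_apply` — the same for the real constraint `re QB` against a real field**: `((re QB)·u)_{(y,μ)} = R^{−(d+1)} Σ_j Σ_{t<R} u(R·y + j + t·e′_μ, μ)`. [folklore] -/
theorem reM_QB_mulVec_apply (u : Tor (fine (R * N) M) × Fin d → ℝ) (i : Tor (fine N M) × Fin d) :
    (reM (QB N R M) *ᵥ u) i = ((R : ℝ) ^ (d + 1))⁻¹ *
      ∑ j : Fin d → Fin R, ∑ t : Fin R, u (cpt N R M i.1 + off N R M j + tstep (fine (R * N) M) i.2 (t : ℕ), i.2) := by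
  apply Complex.ofReal_injective
  have h := QB_mulVec_apply N R M (fun x => ((u x : ℝ) : ℂ)) i
  simp only [Matrix.mulVec, dotProduct] at h ⊢
  push_cast
  rw [← h]
  refine Finset.sum_congr rfl fun x _ => ?_
  rw [reM_apply, ofReal_re_QB]

end Torus

/-! ## §2 The block Poincaré inequality on `ker (re QB)` -/

section Poincare

variable {d : ℕ} (N R : ℕ) [NeZero N] [NeZero R] (M : Fin d → ℕ) [hM : ∀ μ, NeZero (M μ)]

/-- **block × contour sums tile the torus `R` times**: `Σ_y Σ_{j∈[0,R)^d} Σ_{s<R} Ψ(R·y + j + s·e′_μ) = R·Σ_x Ψ(x)` (the blocks tile the fine torus; each contour offset is a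
translation). [folklore] -/
theorem sum_par_off_tstep (Ψ : Tor (fine (R * N) M) → ℝ) (μ : Fin d) :
    ∑ y : Tor (fine N M), ∑ j : Fin d → Fin R, ∑ s : Fin R, Ψ (cpt N R M y + off N R M j + tstep (fine (R * N) M) μ (s : ℕ))
      = (R : ℝ) * ∑ x, Ψ x := by
  have e1 : (∑ y : Tor (fine N M), ∑ j : Fin d → Fin R, ∑ s : Fin R, Ψ (cpt N R M y + off N R M j + tstep (fine (R * N) M) μ (s : ℕ)))
      = ∑ s : Fin R, ∑ y : Tor (fine N M), ∑ j : Fin d → Fin R, Ψ (cpt N R M y + off N R M j + tstep (fine (R * N) M) μ (s : ℕ)) := by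
    rw [Finset.sum_congr rfl fun y _ => Finset.sum_comm, Finset.sum_comm]
  have e2 : ∀ s : Fin R, ∑ y : Tor (fine N M), ∑ j : Fin d → Fin R, Ψ (cpt N R M y + off N R M j + tstep (fine (R * N) M) μ (s : ℕ)) = ∑ x, Ψ x :=
    fun s => (sum_eq_sum_par_off N R M (fun x => Ψ (x + tstep (fine (R * N) M) μ (s : ℕ)))).symm.trans
      (Fintype.sum_equiv (Equiv.addRight (tstep (fine (R * N) M) μ (s : ℕ))) _ _ fun _ => rfl)
  rw [e1, Finset.sum_congr rfl fun s _ => e2 s, Finset.sum_const, Finset.card_univ, Fintype.card_fin, nsmul_eq_mul]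

omit [NeZero N] hM in
/-- **ONE BLOCK OF THE TORUS**: row `(y, μ)` of Bałaban's constraint, `Σ_j Σ_{t<R} u_μ(R·y + j + t·e′_μ) = 0`, gives
`Σ_{x∈B(y)} u_μ(x)² ≤ R^d·2(R−1)²·(d²·CE_{y,μ} + LE_{y,μ})` with the local cube energy `CE_{y,μ} = Σ_{x∈B(y)} Σ_ν |u_μ(x+e′_ν) − u_μ(x)|²` and the local contour energy
`LE_{y,μ} = Σ_{x∈B(y)} Σ_{s<R} |u_μ(x+s·e′_μ+e′_μ) − u_μ(x+s·e′_μ)|²` (§3 with `F j t = u_μ(R·y + j + t·e′_μ)`). [folklore] -/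
theorem block_sq_sum_le_QB (u : Tor (fine (R * N) M) × Fin d → ℝ) (y : Tor (fine N M)) (μ : Fin d)
    (hrow : ∑ j : Fin d → Fin R, ∑ t : Fin R, u (cpt N R M y + off N R M j + tstep (fine (R * N) M) μ (t : ℕ), μ) = 0) :
    ∑ j : Fin d → Fin R, u (cpt N R M y + off N R M j, μ) ^ 2
      ≤ (R : ℝ) ^ d * (2 * ((R : ℝ) - 1) ^ 2 *
          ((d : ℝ) ^ 2 * ∑ j : Fin d → Fin R, ∑ ν : Fin d,
              (u (cpt N R M y + off N R M j + unitVec (fine (R * N) M) ν, μ) - u (cpt N R M y + off N R M j, μ)) ^ 2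
            + ∑ j : Fin d → Fin R, ∑ s : Fin R,
              (u (cpt N R M y + off N R M j + tstep (fine (R * N) M) μ (s : ℕ) + unitVec (fine (R * N) M) μ, μ)
                - u (cpt N R M y + off N R M j + tstep (fine (R * N) M) μ (s : ℕ), μ)) ^ 2)) := by
  have h := block_sq_sum_le (R := R)
    (CE := ∑ j : Fin d → Fin R, ∑ ν : Fin d, (u (cpt N R M y + off N R M j + unitVec (fine (R * N) M) ν, μ) - u (cpt N R M y + off N R M j, μ)) ^ 2)
    (LE := ∑ j : Fin d → Fin R, ∑ s : Fin R, (u (cpt N R M y + off N R M j + tstep (fine (R * N) M) μ (s : ℕ) + unitVec (fine (R * N) M) μ, μ)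
      - u (cpt N R M y + off N R M j + tstep (fine (R * N) M) μ (s : ℕ), μ)) ^ 2)
    (fun j t => u (cpt N R M y + off N R M j + tstep (fine (R * N) M) μ t, μ))
    (by positivity) (by positivity) hrow ?_ ?_
  · simp only [tstep_zero, add_zero] at h
    exact h
  · intro j ν hν
    rw [tstep_zero, add_zero, add_zero, off_update_succ N R M j ν hν, ← add_assoc]
    have h1 : (u (cpt N R M y + off N R M j + unitVec (fine (R * N) M) ν, μ) - u (cpt N R M y + off N R M j, μ)) ^ 2
        ≤ ∑ ν' : Fin d, (u (cpt N R M y + off N R M j + unitVec (fine (R * N) M) ν', μ) - u (cpt N R M y + off N R M j, μ)) ^ 2 :=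
      Finset.single_le_sum (f := fun ν' : Fin d => (u (cpt N R M y + off N R M j + unitVec (fine (R * N) M) ν', μ) - u (cpt N R M y + off N R M j, μ)) ^ 2)
        (fun _ _ => sq_nonneg _) (Finset.mem_univ ν)
    exact h1.trans (Finset.single_le_sum (f := fun j : Fin d → Fin R => ∑ ν' : Fin d,
      (u (cpt N R M y + off N R M j + unitVec (fine (R * N) M) ν', μ) - u (cpt N R M y + off N R M j, μ)) ^ 2)
        (fun _ _ => Finset.sum_nonneg fun _ _ => sq_nonneg _) (Finset.mem_univ j))
  · intro j s hs
    rw [tstep_succ, ← add_assoc]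
    obtain ⟨s', rfl⟩ : ∃ s' : Fin R, (s' : ℕ) = s := ⟨⟨s, by omega⟩, rfl⟩
    have h1 : (u (cpt N R M y + off N R M j + tstep (fine (R * N) M) μ (s' : ℕ) + unitVec (fine (R * N) M) μ, μ)
          - u (cpt N R M y + off N R M j + tstep (fine (R * N) M) μ (s' : ℕ), μ)) ^ 2
        ≤ ∑ s'' : Fin R, (u (cpt N R M y + off N R M j + tstep (fine (R * N) M) μ (s'' : ℕ) + unitVec (fine (R * N) M) μ, μ)
          - u (cpt N R M y + off N R M j + tstep (fine (R * N) M) μ (s'' : ℕ), μ)) ^ 2 :=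
      Finset.single_le_sum (f := fun s'' : Fin R => (u (cpt N R M y + off N R M j + tstep (fine (R * N) M) μ (s'' : ℕ) + unitVec (fine (R * N) M) μ, μ)
          - u (cpt N R M y + off N R M j + tstep (fine (R * N) M) μ (s'' : ℕ), μ)) ^ 2)
        (fun _ _ => sq_nonneg _) (Finset.mem_univ s')
    exact h1.trans (Finset.single_le_sum (f := fun j : Fin d → Fin R => ∑ s' : Fin R,
      (u (cpt N R M y + off N R M j + tstep (fine (R * N) M) μ (s' : ℕ) + unitVec (fine (R * N) M) μ, μ)
        - u (cpt N R M y + off N R M j + tstep (fine (R * N) M) μ (s' : ℕ), μ)) ^ 2)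
        (fun _ _ => Finset.sum_nonneg fun _ _ => sq_nonneg _) (Finset.mem_univ j))

/-- **`dotProduct_self_le_gradSq_of_reM_QB` — THE BLOCK POINCARÉ INEQUALITY ON THE KERNEL OF BAŁABAN's ONE-STEP AVERAGING**: for every real fine field `u` with
`(re QB)·u = 0`,  `|u|² ≤ 2R^d(R−1)²(d²+R) · Σ_{(x,μ)} Σ_ν |u(x+e′_ν, μ) − u(x, μ)|²` — the constant depends on `(d, R)` only, NOT on `N` and NOT on the torus `M`.
[folklore] -/
theorem dotProduct_self_le_gradSq_of_reM_QB (u : Tor (fine (R * N) M) × Fin d → ℝ) (hu : reM (QB N R M) *ᵥ u = 0) :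
    u ⬝ᵥ u ≤ 2 * (R : ℝ) ^ d * ((R : ℝ) - 1) ^ 2 * ((d : ℝ) ^ 2 + R) *
      ∑ i : Tor (fine (R * N) M) × Fin d, ∑ ν : Fin d, (u (i.1 + unitVec (fine (R * N) M) ν, i.2) - u i) ^ 2 := by
  have hR : (0 : ℝ) < R := by exact_mod_cast Nat.pos_of_ne_zero (NeZero.ne R)
  set G : ℝ := ∑ i : Tor (fine (R * N) M) × Fin d, ∑ ν : Fin d, (u (i.1 + unitVec (fine (R * N) M) ν, i.2) - u i) ^ 2 with hG
  -- the per-component site energies and the local block energies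
  set Φ : Fin d → Tor (fine (R * N) M) → ℝ := fun μ x => ∑ ν : Fin d, (u (x + unitVec (fine (R * N) M) ν, μ) - u (x, μ)) ^ 2 with hΦ
  set Ψ : Fin d → Tor (fine (R * N) M) → ℝ := fun μ x => (u (x + unitVec (fine (R * N) M) μ, μ) - u (x, μ)) ^ 2 with hΨ
  set CE : Fin d → Tor (fine N M) → ℝ := fun μ y => ∑ j : Fin d → Fin R, ∑ ν : Fin d,
    (u (cpt N R M y + off N R M j + unitVec (fine (R * N) M) ν, μ) - u (cpt N R M y + off N R M j, μ)) ^ 2 with hCE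
  set LE : Fin d → Tor (fine N M) → ℝ := fun μ y => ∑ j : Fin d → Fin R, ∑ s : Fin R,
    (u (cpt N R M y + off N R M j + tstep (fine (R * N) M) μ (s : ℕ) + unitVec (fine (R * N) M) μ, μ)
      - u (cpt N R M y + off N R M j + tstep (fine (R * N) M) μ (s : ℕ), μ)) ^ 2 with hLE
  -- the rows of the constraint
  have hrow : ∀ (y : Tor (fine N M)) (μ : Fin d),
      ∑ j : Fin d → Fin R, ∑ t : Fin R, u (cpt N R M y + off N R M j + tstep (fine (R * N) M) μ (t : ℕ), μ) = 0 := by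
    intro y μ
    have h := congrFun hu (y, μ)
    rw [reM_QB_mulVec_apply, Pi.zero_apply] at h
    exact (mul_eq_zero.mp h).resolve_left (inv_ne_zero (pow_ne_zero _ hR.ne'))
  -- block by block
  have hblock : ∀ (μ : Fin d) (y : Tor (fine N M)),
      ∑ j : Fin d → Fin R, u (cpt N R M y + off N R M j, μ) ^ 2 ≤ (R : ℝ) ^ d * (2 * ((R : ℝ) - 1) ^ 2 * ((d : ℝ) ^ 2 * CE μ y + LE μ y)) :=
    fun μ y => block_sq_sum_le_QB N R M u y μ (hrow y μ)
  -- the left-hand side, block by block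
  have hL : u ⬝ᵥ u = ∑ μ : Fin d, ∑ y : Tor (fine N M), ∑ j : Fin d → Fin R, u (cpt N R M y + off N R M j, μ) ^ 2 := by
    rw [dotProduct, Fintype.sum_prod_type, Finset.sum_comm]
    refine Finset.sum_congr rfl fun μ _ => ?_
    simp only [← pow_two]
    exact sum_eq_sum_par_off N R M (fun x => u (x, μ) ^ 2)
  -- the cube energies add up to the gradient form
  have hGΦ : ∑ μ : Fin d, ∑ x : Tor (fine (R * N) M), Φ μ x = G := by
    rw [hG, Fintype.sum_prod_type, Finset.sum_comm]
  have hCEsum : ∑ μ : Fin d, ∑ y : Tor (fine N M), CE μ y = G := by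
    rw [← hGΦ]
    exact Finset.sum_congr rfl fun μ _ => (sum_eq_sum_par_off N R M (Φ μ)).symm
  -- the contour energies add up to at most `R` times the gradient form
  have hLEsum : ∑ μ : Fin d, ∑ y : Tor (fine N M), LE μ y ≤ (R : ℝ) * G := by
    have e : ∀ μ : Fin d, ∑ y : Tor (fine N M), LE μ y = (R : ℝ) * ∑ x, Ψ μ x := fun μ => sum_par_off_tstep N R M (Ψ μ) μ
    have hle : ∀ (μ : Fin d) (x : Tor (fine (R * N) M)), Ψ μ x ≤ Φ μ x := fun μ x =>
      Finset.single_le_sum (f := fun ν : Fin d => (u (x + unitVec (fine (R * N) M) ν, μ) - u (x, μ)) ^ 2) (fun _ _ => sq_nonneg _) (Finset.mem_univ μ)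
    calc ∑ μ : Fin d, ∑ y : Tor (fine N M), LE μ y = ∑ μ : Fin d, (R : ℝ) * ∑ x, Ψ μ x := Finset.sum_congr rfl fun μ _ => e μ
      _ ≤ ∑ μ : Fin d, (R : ℝ) * ∑ x, Φ μ x := Finset.sum_le_sum fun μ _ =>
          mul_le_mul_of_nonneg_left (Finset.sum_le_sum fun x _ => hle μ x) hR.le
      _ = (R : ℝ) * G := by rw [← Finset.mul_sum, hGΦ]
  -- assembly
  have hK0 : 0 ≤ (R : ℝ) ^ d * (2 * ((R : ℝ) - 1) ^ 2) := by positivity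
  calc u ⬝ᵥ u = ∑ μ : Fin d, ∑ y : Tor (fine N M), ∑ j : Fin d → Fin R, u (cpt N R M y + off N R M j, μ) ^ 2 := hL
    _ ≤ ∑ μ : Fin d, ∑ y : Tor (fine N M), (R : ℝ) ^ d * (2 * ((R : ℝ) - 1) ^ 2 * ((d : ℝ) ^ 2 * CE μ y + LE μ y)) :=
        Finset.sum_le_sum fun μ _ => Finset.sum_le_sum fun y _ => hblock μ y
    _ = (R : ℝ) ^ d * (2 * ((R : ℝ) - 1) ^ 2) * ((d : ℝ) ^ 2 * (∑ μ : Fin d, ∑ y : Tor (fine N M), CE μ y) + ∑ μ : Fin d, ∑ y : Tor (fine N M), LE μ y) := by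
        have e : ∀ (μ : Fin d) (y : Tor (fine N M)), (R : ℝ) ^ d * (2 * ((R : ℝ) - 1) ^ 2 * ((d : ℝ) ^ 2 * CE μ y + LE μ y))
            = ((R : ℝ) ^ d * (2 * ((R : ℝ) - 1) ^ 2) * (d : ℝ) ^ 2) * CE μ y + ((R : ℝ) ^ d * (2 * ((R : ℝ) - 1) ^ 2)) * LE μ y := by
          intro μ y; ring
        simp_rw [e, Finset.sum_add_distrib, ← Finset.mul_sum]
        ring
    _ ≤ (R : ℝ) ^ d * (2 * ((R : ℝ) - 1) ^ 2) * ((d : ℝ) ^ 2 * G + (R : ℝ) * G) := by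
        rw [hCEsum]
        exact mul_le_mul_of_nonneg_left (add_le_add le_rfl hLEsum) hK0
    _ = 2 * (R : ℝ) ^ d * ((R : ℝ) - 1) ^ 2 * ((d : ℝ) ^ 2 + R) * G := by ring

/-- **`ker_coercive_of_gradSq` — GRADIENT-FORM LOWER BOUND ⟹ KERNEL COERCIVITY ON `ker (re QB)`** (PART 169 `coercive_reg_QB` ∕ PART 170 `abs_flucCov_le_QB`'s letter `hker`):
if a real fine form dominates the gradient form, `γ·Σ_{(x,μ),ν}|u(x+e′_ν,μ) − u(x,μ)|² ≤ ⟨u, Hu⟩` for all `u` (`γ ≥ 0`), then on the kernel of Bałaban's averaging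
`γ₀·|z|² ≤ ⟨z, Hz⟩` with `γ₀ = γ ∕ (2R^d(R−1)²(d²+R))`, uniformly in `N` and the torus. [folklore] -/
theorem ker_coercive_of_gradSq {H : Matrix (Tor (fine (R * N) M) × Fin d) (Tor (fine (R * N) M) × Fin d) ℝ} {γ : ℝ} (hγ : 0 ≤ γ)
    (hH : ∀ u : Tor (fine (R * N) M) × Fin d → ℝ,
      γ * ∑ i : Tor (fine (R * N) M) × Fin d, ∑ ν : Fin d, (u (i.1 + unitVec (fine (R * N) M) ν, i.2) - u i) ^ 2 ≤ u ⬝ᵥ (H *ᵥ u))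
    (z : Tor (fine (R * N) M) × Fin d → ℝ) (hz : reM (QB N R M) *ᵥ z = 0) :
    γ / (2 * (R : ℝ) ^ d * ((R : ℝ) - 1) ^ 2 * ((d : ℝ) ^ 2 + R)) * (z ⬝ᵥ z) ≤ z ⬝ᵥ (H *ᵥ z) := by
  set C : ℝ := 2 * (R : ℝ) ^ d * ((R : ℝ) - 1) ^ 2 * ((d : ℝ) ^ 2 + R) with hC
  set G : ℝ := ∑ i : Tor (fine (R * N) M) × Fin d, ∑ ν : Fin d, (z (i.1 + unitVec (fine (R * N) M) ν, i.2) - z i) ^ 2 with hG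
  have hP : z ⬝ᵥ z ≤ C * G := dotProduct_self_le_gradSq_of_reM_QB N R M z hz
  have hC0 : 0 ≤ C := by
    have hR : (0 : ℝ) < R := by exact_mod_cast Nat.pos_of_ne_zero (NeZero.ne R)
    rw [hC]; positivity
  rcases hC0.eq_or_lt with hC00 | hCpos
  · rw [← hC00, div_zero, zero_mul]
    -- `C = 0` forces `z = 0`
    have hz0 : z ⬝ᵥ z ≤ 0 := by rw [← hC00, zero_mul] at hP; exact hP
    have hzz : z = 0 := dotProduct_self_eq_zero.mp (le_antisymm hz0 (by rw [dotProduct]; exact Finset.sum_nonneg fun i _ => mul_self_nonneg _))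
    rw [hzz, Matrix.mulVec_zero, dotProduct_zero]
  · calc γ / C * (z ⬝ᵥ z) ≤ γ / C * (C * G) := mul_le_mul_of_nonneg_left hP (div_nonneg hγ hC0)
      _ = γ * G := by field_simp
      _ ≤ z ⬝ᵥ (H *ᵥ z) := hH z

end Poincare

/-! ## §3 The `ℂ` currency: `QB·v = 0 ⟹ nsq v ≤ C·Σ‖∇v‖²`, and PART 173's `hkerC` from a gradient-form lower bound -/

section ComplexCurrency

variable {d : ℕ} (N R : ℕ) [NeZero N] [NeZero R] (M : Fin d → ℕ) [hM : ∀ μ, NeZero (M μ)]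

/-- `re (QB·v) = (re QB)·(re v)` (the entries of `QB` are real, PART 167 `isReal_QB`). [folklore] -/
theorem re_QB_mulVec (v : Tor (fine (R * N) M) × Fin d → ℂ) :
    (fun i => ((QB N R M *ᵥ v) i).re) = reM (QB N R M) *ᵥ fun x => (v x).re := by
  funext i
  simp only [Matrix.mulVec, dotProduct, Complex.re_sum, reM_apply, Complex.mul_re, (isReal_QB N R M).im_eq_zero, zero_mul, sub_zero]

/-- `im (QB·v) = (re QB)·(im v)`. [folklore] -/
theorem im_QB_mulVec (v : Tor (fine (R * N) M) × Fin d → ℂ) :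
    (fun i => ((QB N R M *ᵥ v) i).im) = reM (QB N R M) *ᵥ fun x => (v x).im := by
  funext i
  simp only [Matrix.mulVec, dotProduct, Complex.im_sum, reM_apply, Complex.mul_im, (isReal_QB N R M).im_eq_zero, zero_mul, add_zero]

/-- **`nsq_le_gradSq_of_QB` — THE BLOCK POINCARÉ INEQUALITY IN THE `ℂ` CURRENCY**: `QB·v = 0 ⟹ nsq v ≤ 2R^d(R−1)²(d²+R)·Σ_{(x,μ),ν} ‖v(x+e′_ν,μ) − v(x,μ)‖²`
(real and imaginary parts separately, §4). [folklore] -/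
theorem nsq_le_gradSq_of_QB (v : Tor (fine (R * N) M) × Fin d → ℂ) (hv : QB N R M *ᵥ v = 0) :
    nsq v ≤ 2 * (R : ℝ) ^ d * ((R : ℝ) - 1) ^ 2 * ((d : ℝ) ^ 2 + R) *
      ∑ i : Tor (fine (R * N) M) × Fin d, ∑ ν : Fin d, ‖v (i.1 + unitVec (fine (R * N) M) ν, i.2) - v i‖ ^ 2 := by
  set C : ℝ := 2 * (R : ℝ) ^ d * ((R : ℝ) - 1) ^ 2 * ((d : ℝ) ^ 2 + R) with hC
  set vr : Tor (fine (R * N) M) × Fin d → ℝ := fun x => (v x).re with hvr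
  set vi : Tor (fine (R * N) M) × Fin d → ℝ := fun x => (v x).im with hvi
  have hre : reM (QB N R M) *ᵥ vr = 0 := by
    rw [hvr, ← re_QB_mulVec, hv]; rfl
  have him : reM (QB N R M) *ᵥ vi = 0 := by
    rw [hvi, ← im_QB_mulVec, hv]; rfl
  have h1 := dotProduct_self_le_gradSq_of_reM_QB N R M vr hre
  have h2 := dotProduct_self_le_gradSq_of_reM_QB N R M vi him
  have e1 : nsq v = vr ⬝ᵥ vr + vi ⬝ᵥ vi := by
    simp only [nsq, dotProduct, ← Finset.sum_add_distrib, Complex.sq_norm, Complex.normSq_apply, hvr, hvi]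
  have e2 : (∑ i : Tor (fine (R * N) M) × Fin d, ∑ ν : Fin d, ‖v (i.1 + unitVec (fine (R * N) M) ν, i.2) - v i‖ ^ 2)
      = (∑ i : Tor (fine (R * N) M) × Fin d, ∑ ν : Fin d, (vr (i.1 + unitVec (fine (R * N) M) ν, i.2) - vr i) ^ 2)
        + ∑ i : Tor (fine (R * N) M) × Fin d, ∑ ν : Fin d, (vi (i.1 + unitVec (fine (R * N) M) ν, i.2) - vi i) ^ 2 := by
    rw [← Finset.sum_add_distrib]
    refine Finset.sum_congr rfl fun i _ => ?_
    rw [← Finset.sum_add_distrib]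
    refine Finset.sum_congr rfl fun ν _ => ?_
    rw [Complex.sq_norm, Complex.normSq_apply, Complex.sub_re, Complex.sub_im, hvr, hvi]
    ring
  rw [e1, e2, mul_add]
  exact add_le_add h1 h2

/-- **`ker_coerciveC_of_gradSq` — PART 173's LETTER `hkerC` FROM A GRADIENT-FORM LOWER BOUND**: if `γ·Σ_{(x,μ),ν}‖v(x+e′_ν,μ) − v(x,μ)‖² ≤ re⟨v, Av⟩` for all `v` (`γ ≥ 0`), then
`QB·v = 0 ⟹ (γ ∕ (2R^d(R−1)²(d²+R)))·nsq v ≤ re⟨v, Av⟩` — the `ℂ`-kernel coercivity consumed by `OneStepConstraintModelLetters.ker_coercive_reM_QB` ∕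
`abs_flucCov_le_QB_of_complexLetters`, uniformly in `N` and the torus. [folklore] -/
theorem ker_coerciveC_of_gradSq {A : Matrix (Tor (fine (R * N) M) × Fin d) (Tor (fine (R * N) M) × Fin d) ℂ} {γ : ℝ} (hγ : 0 ≤ γ)
    (hA : ∀ v : Tor (fine (R * N) M) × Fin d → ℂ,
      γ * ∑ i : Tor (fine (R * N) M) × Fin d, ∑ ν : Fin d, ‖v (i.1 + unitVec (fine (R * N) M) ν, i.2) - v i‖ ^ 2 ≤ (star v ⬝ᵥ (A *ᵥ v)).re)
    (v : Tor (fine (R * N) M) × Fin d → ℂ) (hv : QB N R M *ᵥ v = 0) :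
    γ / (2 * (R : ℝ) ^ d * ((R : ℝ) - 1) ^ 2 * ((d : ℝ) ^ 2 + R)) * nsq v ≤ (star v ⬝ᵥ (A *ᵥ v)).re := by
  set C : ℝ := 2 * (R : ℝ) ^ d * ((R : ℝ) - 1) ^ 2 * ((d : ℝ) ^ 2 + R) with hC
  set G : ℝ := ∑ i : Tor (fine (R * N) M) × Fin d, ∑ ν : Fin d, ‖v (i.1 + unitVec (fine (R * N) M) ν, i.2) - v i‖ ^ 2 with hG
  have hP : nsq v ≤ C * G := nsq_le_gradSq_of_QB N R M v hv
  have hC0 : 0 ≤ C := by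
    have hR : (0 : ℝ) < R := by exact_mod_cast Nat.pos_of_ne_zero (NeZero.ne R)
    rw [hC]; positivity
  rcases hC0.eq_or_lt with hC00 | hCpos
  · rw [← hC00, div_zero, zero_mul]
    -- `C = 0` forces `v = 0`
    have hn0 : nsq v = 0 := le_antisymm (by rw [← hC00, zero_mul] at hP; exact hP) (nsq_nonneg v)
    have hvz : v = 0 := by
      funext i
      have h := (Finset.sum_eq_zero_iff_of_nonneg fun i _ => sq_nonneg ‖v i‖).mp hn0 i (Finset.mem_univ i)
      exact norm_eq_zero.mp (pow_eq_zero_iff two_ne_zero |>.mp h)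
    rw [hvz, Matrix.mulVec_zero, dotProduct_zero, Complex.zero_re]
  · calc γ / C * nsq v ≤ γ / C * (C * G) := mul_le_mul_of_nonneg_left hP (div_nonneg hγ hC0)
      _ = γ * G := by field_simp
      _ ≤ (star v ⬝ᵥ (A *ᵥ v)).re := hA v

end ComplexCurrency

/-! ## §4 Along Bałaban's tower: the kernel of `QBlev L M k` at every level, one constant -/

section Tower

variable {d : ℕ} (L : ℕ) [NeZero L] (M : Fin d → ℕ) [hM : ∀ μ, NeZero (M μ)]

/-- **`nsq_le_gradSq_of_QBlev` — ALONG THE TOWER**: for every level `k` and every `v` on `idx L M (k+1)` with `QBlev L M k · v = 0`,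
`nsq v ≤ 2L^d(L−1)²(d²+L) · Σ_{(x,μ),ν}‖v(x+e_ν,μ) − v(x,μ)‖²` — the SAME constant at every level (`QBlev L M k = QB (lev L k) L M` by definition; census V197's
option (ii) is the case `k = 0`). [folklore] -/
theorem nsq_le_gradSq_of_QBlev (k : ℕ) (v : idx L M (k + 1) → ℂ) (hv : QBlev L M k *ᵥ v = 0) :
    nsq v ≤ 2 * (L : ℝ) ^ d * ((L : ℝ) - 1) ^ 2 * ((d : ℝ) ^ 2 + L) *
      ∑ i : idx L M (k + 1), ∑ ν : Fin d, ‖v (i.1 + unitVec (fine (lev L (k + 1)) M) ν, i.2) - v i‖ ^ 2 :=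
  nsq_le_gradSq_of_QB (lev L k) L M v hv

/-- **`ker_coerciveC_of_gradSq_lev` — the k-UNIFORM `hkerC` from a k-uniform gradient-form lower bound**: if a level-`(k+1)` form `A` satisfies
`γ·Σ‖∇v‖² ≤ re⟨v, Av⟩` for all `v`, then `QBlev L M k · v = 0 ⟹ (γ ∕ (2L^d(L−1)²(d²+L)))·nsq v ≤ re⟨v, Av⟩` — with `γ` independent of `k`, so is the kernel
coercivity constant. [folklore] -/
theorem ker_coerciveC_of_gradSq_lev (k : ℕ) {A : Matrix (idx L M (k + 1)) (idx L M (k + 1)) ℂ} {γ : ℝ} (hγ : 0 ≤ γ)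
    (hA : ∀ v : idx L M (k + 1) → ℂ,
      γ * ∑ i : idx L M (k + 1), ∑ ν : Fin d, ‖v (i.1 + unitVec (fine (lev L (k + 1)) M) ν, i.2) - v i‖ ^ 2 ≤ (star v ⬝ᵥ (A *ᵥ v)).re)
    (v : idx L M (k + 1) → ℂ) (hv : QBlev L M k *ᵥ v = 0) :
    γ / (2 * (L : ℝ) ^ d * ((L : ℝ) - 1) ^ 2 * ((d : ℝ) ^ 2 + L)) * nsq v ≤ (star v ⬝ᵥ (A *ᵥ v)).re :=
  ker_coerciveC_of_gradSq (lev L k) L M hγ hA v hv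

end Tower

end Summit.QuantumFields.BalabanUV.Beta.GAN24.OneStepConstraintPoincare

end
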